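import Mathlib.LinearAlgebra.PerfectPairing.Basic
import Mathlib.LinearAlgebra.Dual.Lemmas
import HarnessLib

/-!
# Adjoints across perfect pairings: existence, invertibility, and the transpose of a decomposition

Topic `Literature/Topology/FourManifolds`; lattice algebra in the cone of the named fact
`Literature.Topology.FourManifolds.isHCobordant_of_equivalent_intersectionForm` (**Wall 1964,
Thm. 2**; C. T. C. Wall, *On simply-connected 4-manifolds*, J. London Math. Soc. 39 (1964)
141–149; `HCobordismDonaldson.lean`), companion of `LatticeDualityAnnihilator.lean` and
`KroneckerFreeCohomology.lean` (the homology/cohomology dictionary of Wall's proof through the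
Kronecker pairing `H²(X; ℤ)/T × H₂(X; ℤ) → ℤ`, perfect for closed simply connected 4-manifolds).

Wall identifies the "quadratic form" of a simply connected 4-manifold indifferently on `H₂` and
on `H²` (p. 141) and composes isomorphisms of such forms with maps induced in homology (p. 146,
"the composite induces the isomorphism `−α` of `H₂(M₁)` on `H₂(M₂)`"). Across a perfect pairing
every map of cohomology lattices has a unique ADJOINT on the homology lattices; this file proves
the three facts about adjoints the dictionary uses, for perfect pairings
`κ : C →ₗ H →ₗ R` (`LinearMap.IsPerfPair`) over any commutative ring `R`:

* `exists_adjoint` — **every `α : C₁ → C₂` has an adjoint `α† : H₂ → H₁`**,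
  `κ₂ (α a) y = κ₁ a (α† y)`, as soon as `κ₁` is perfect (`α† = (κ₁♭)⁻¹ ∘ α^∨ ∘ κ₂♭`).
* `exists_adjoint_bijective` — **if `α` is bijective and both pairings are perfect, the adjoint
  is bijective** (Wall's `α` is an isometry `H²(M₁)/T ≅ H²(M₂)/T`; its adjoint
  `H₂(M₂) ≅ H₂(M₁)` is the isomorphism of p. 146).
* `bijective_transpose_of_bijective` — **the transpose of a decomposition is a decomposition**:
  if `(a, b) ↦ c_M a + c_N b : C_M × C_N → C_P` is bijective (the cohomological splitting
  `Hᵏ(M # N)/T ≅ Hᵏ(M)/T ⊕ Hᵏ(N)/T` of `ConnectedSumCohomology.lean`) and `c_M`, `c_N` have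
  adjoints `c_M†`, `c_N†` (the maps induced by the collapses IN HOMOLOGY, by naturality of the
  Kronecker pairing), all three pairings being perfect, then `x ↦ (c_M† x, c_N† x) : H_P → H_M × H_N`
  is bijective — the HOMOLOGICAL splitting `H₂(M # N) ≅ H₂(M) ⊕ H₂(N)` of Wall's p. 144, obtained
  without a second Mayer–Vietoris computation.

Everything is proved over an arbitrary commutative ring (so no `ℤ`-instance bookkeeping is
needed by the consumers); no definition and no named fact is introduced.

## References

* C. T. C. Wall, *On simply-connected 4-manifolds*, J. London Math. Soc. 39 (1964) 141–149,
  pp. 141, 144, 146. [WallJLMS1964]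
* A. Hatcher, *Algebraic Topology*, CUP (2002), §3.1 pp. 191–201. [HatcherAT2002]
-/

open Function Module

noncomputable section

namespace Literature.Topology.FourManifolds

variable {R : Type*} [CommRing R]

/-! ### Existence and invertibility of adjoints -/

section Adjoint

variable {C₁ H₁ C₂ H₂ : Type*} [AddCommGroup C₁] [Module R C₁] [AddCommGroup H₁] [Module R H₁]
  [AddCommGroup C₂] [Module R C₂] [AddCommGroup H₂] [Module R H₂]

/-- **Every map of cohomology lattices has an adjoint on the homology lattices** across a
perfect pairing: for `κ₁ : C₁ × H₁ → R` perfect, any pairing `κ₂ : C₂ × H₂ → R` and any linear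
`α : C₁ → C₂` there is `α† : H₂ → H₁` with `κ₂ (α a) y = κ₁ a (α† y)` — namely
`α† y = (κ₁♭)⁻¹ (a ↦ κ₂ (α a) y)`. (For the Kronecker pairings and `α = f^*` the adjoint is `f_*`,
Hatcher 2002 p. 201.) [cite: HatcherAT2002, §3.1 p. 201] -/
theorem exists_adjoint (κ₁ : C₁ →ₗ[R] H₁ →ₗ[R] R) [κ₁.IsPerfPair] (κ₂ : C₂ →ₗ[R] H₂ →ₗ[R] R)
    (α : C₁ →ₗ[R] C₂) : ∃ β : H₂ →ₗ[R] H₁, ∀ a y, κ₂ (α a) y = κ₁ a (β y) := by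
  let e₁ : H₁ ≃ₗ[R] Dual R C₁ :=
    LinearEquiv.ofBijective κ₁.flip (LinearMap.IsPerfPair.bijective_right κ₁)
  refine ⟨e₁.symm.toLinearMap ∘ₗ α.dualMap ∘ₗ κ₂.flip, fun a y => ?_⟩
  have h : κ₁ a ((e₁.symm.toLinearMap ∘ₗ α.dualMap ∘ₗ κ₂.flip) y) =
      e₁ (e₁.symm (α.dualMap (κ₂.flip y))) a := rfl
  rw [h, LinearEquiv.apply_symm_apply]
  rfl

/-- **The adjoint of a bijection is a bijection** when both pairings are perfect: for
`α : C₁ ≅ C₂` the adjoint `α† = (κ₁♭)⁻¹ ∘ α^∨ ∘ κ₂♭ : H₂ → H₁` is a composite of isomorphisms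
(Wall 1964, p. 146: the isometry `α` of the forms and "the isomorphism `−α` of `H₂(M₁)` on
`H₂(M₂)`"). [cite: WallJLMS1964, §2 p. 146] [cite: HatcherAT2002, §3.1 p. 201] -/
theorem exists_adjoint_bijective (κ₁ : C₁ →ₗ[R] H₁ →ₗ[R] R) [κ₁.IsPerfPair]
    (κ₂ : C₂ →ₗ[R] H₂ →ₗ[R] R) [κ₂.IsPerfPair] {α : C₁ →ₗ[R] C₂} (hα : Bijective α) :
    ∃ β : H₂ →ₗ[R] H₁, Bijective β ∧ ∀ a y, κ₂ (α a) y = κ₁ a (β y) := by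
  let e₁ : H₁ ≃ₗ[R] Dual R C₁ :=
    LinearEquiv.ofBijective κ₁.flip (LinearMap.IsPerfPair.bijective_right κ₁)
  let e₂ : H₂ ≃ₗ[R] Dual R C₂ :=
    LinearEquiv.ofBijective κ₂.flip (LinearMap.IsPerfPair.bijective_right κ₂)
  let eα : C₁ ≃ₗ[R] C₂ := LinearEquiv.ofBijective α hα
  let β : H₂ ≃ₗ[R] H₁ := e₂.trans (eα.dualMap.trans e₁.symm)
  refine ⟨β.toLinearMap, β.bijective, fun a y => ?_⟩
  change κ₂ (α a) y = κ₁ a (β y)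
  have h : κ₁ a (β y) = e₁ (e₁.symm (eα.dualMap (e₂ y))) a := rfl
  rw [h, LinearEquiv.apply_symm_apply]
  rfl

/-- Uniqueness of adjoints: two adjoints of the same map across a pairing `κ₁` whose right
adjoint `κ₁♭ : H₁ → Dual C₁` is one-to-one (e.g. `κ₁` perfect) agree. [folklore] -/
theorem adjoint_unique (κ₁ : C₁ →ₗ[R] H₁ →ₗ[R] R) (hκ₁ : Injective κ₁.flip)
    (κ₂ : C₂ →ₗ[R] H₂ →ₗ[R] R) {α : C₁ →ₗ[R] C₂} {β β' : H₂ →ₗ[R] H₁}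
    (hβ : ∀ a y, κ₂ (α a) y = κ₁ a (β y)) (hβ' : ∀ a y, κ₂ (α a) y = κ₁ a (β' y)) : β = β' := by
  ext y
  refine hκ₁ (LinearMap.ext fun a => ?_)
  change κ₁ a (β y) = κ₁ a (β' y)
  rw [← hβ, hβ']

end Adjoint

/-! ### The transpose of a decomposition is a decomposition -/

section Transpose

variable {CP HP CM HM CN HN : Type*} [AddCommGroup CP] [Module R CP] [AddCommGroup HP]
  [Module R HP] [AddCommGroup CM] [Module R CM] [AddCommGroup HM] [Module R HM]
  [AddCommGroup CN] [Module R CN] [AddCommGroup HN] [Module R HN]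

/-- **The transpose of a decomposition is a decomposition** (Wall 1964, p. 144,
"`H₂(N) ≅ H₂(M₁) ⊕ H₂(M₂)`", obtained here from the COHOMOLOGICAL splitting by duality): let
`κ_P`, `κ_M`, `κ_N` be perfect pairings, `c_M : C_M → C_P`, `c_N : C_N → C_P` with adjoints
`c_M† : H_P → H_M`, `c_N† : H_P → H_N` (`κ_P (c_M a) x = κ_M a (c_M† x)`, likewise for `N`). If
`(a, b) ↦ c_M a + c_N b` is bijective then so is `x ↦ (c_M† x, c_N† x)`. One-to-one: such an `x`
pairs to zero with every `c_M a + c_N b`, i.e. with all of `C_P`. Onto: the functional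
`w ↦ κ_M (σ₁ w) y + κ_N (σ₂ w) z` on `C_P` (`σ` the inverse splitting) is `κ_P (-) x` for some
`x`, and then `c_M† x = y`, `c_N† x = z` by perfectness of `κ_M`, `κ_N`.
[cite: WallJLMS1964, §2 p. 144] [cite: HatcherAT2002, §3.1 p. 201] -/
theorem bijective_transpose_of_bijective (κP : CP →ₗ[R] HP →ₗ[R] R) [κP.IsPerfPair]
    (κM : CM →ₗ[R] HM →ₗ[R] R) [κM.IsPerfPair] (κN : CN →ₗ[R] HN →ₗ[R] R) [κN.IsPerfPair]
    {cMc : CM →ₗ[R] CP} {cNc : CN →ₗ[R] CP} {cMh : HP →ₗ[R] HM} {cNh : HP →ₗ[R] HN}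
    (hM : ∀ a x, κP (cMc a) x = κM a (cMh x)) (hN : ∀ b x, κP (cNc b) x = κN b (cNh x))
    (hc : Bijective fun ab : CM × CN => cMc ab.1 + cNc ab.2) :
    Bijective fun x : HP => (cMh x, cNh x) := by
  -- the cohomological splitting as a linear equivalence
  have hc' : Bijective (cMc.coprod cNc) := hc
  let Φ : (CM × CN) ≃ₗ[R] CP := LinearEquiv.ofBijective (cMc.coprod cNc) hc'
  have hΦ : ∀ a b, Φ (a, b) = cMc a + cNc b := fun a b => rfl
  constructor
  · -- one-to-one
    intro x x' hxx'
    simp only [Prod.mk.injEq] at hxx'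
    have hflip : κP.flip x = κP.flip x' := by
      refine LinearMap.ext fun w => ?_
      obtain ⟨⟨a, b⟩, rfl⟩ := Φ.surjective w
      change κP (Φ (a, b)) x = κP (Φ (a, b)) x'
      rw [hΦ, map_add, LinearMap.add_apply, LinearMap.add_apply, hM, hN, hM, hN, hxx'.1,
        hxx'.2]
    exact (LinearMap.IsPerfPair.bijective_right κP).1 hflip
  · -- onto
    rintro ⟨y, z⟩
    let σ : CP →ₗ[R] CM × CN := Φ.symm.toLinearMap
    let g : Dual R CP :=
      κM.flip y ∘ₗ (LinearMap.fst R CM CN ∘ₗ σ) + κN.flip z ∘ₗ (LinearMap.snd R CM CN ∘ₗ σ)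
    have hg : ∀ a b, g (cMc a + cNc b) = κM a y + κN b z := fun a b => by
      have hσ : σ (cMc a + cNc b) = (a, b) := by
        change Φ.symm (cMc a + cNc b) = (a, b)
        rw [← hΦ, LinearEquiv.symm_apply_apply]
      simp only [g, LinearMap.add_apply, LinearMap.coe_comp, Function.comp_apply, hσ,
        LinearMap.fst_apply, LinearMap.snd_apply]
      rfl
    obtain ⟨x, hx⟩ := (LinearMap.IsPerfPair.bijective_right κP).2 g
    refine ⟨x, Prod.ext ?_ ?_⟩
    · -- `cMh x = y`: compare `κM a (cMh x) = κP (cMc a) x = g (cMc a) = κM a y`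
      refine (LinearMap.IsPerfPair.bijective_right κM).1 (LinearMap.ext fun a => ?_)
      change κM a (cMh x) = κM a y
      have h := hg a 0
      rw [map_zero, add_zero, map_zero, LinearMap.zero_apply, add_zero] at h
      rw [← hM, ← h]
      exact LinearMap.congr_fun hx (cMc a)
    · refine (LinearMap.IsPerfPair.bijective_right κN).1 (LinearMap.ext fun b => ?_)
      change κN b (cNh x) = κN b z
      have h := hg 0 b
      rw [map_zero, zero_add, map_zero, LinearMap.zero_apply, zero_add] at h
      rw [← hN, ← h]
      exact LinearMap.congr_fun hx (cNc b)

end Transpose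

end Literature.Topology.FourManifolds

end
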